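import Summits.Ventures.LatticeQCDFlow.Exactness.IMHAcceptanceGeHalfESS
import HarnessLib

/-!
# The Dirichlet form of the flow sampler and its rank-one Doeblin minorant

HONEST FRAMING: exact (Metropolis-corrected) sampling algorithms for lattice gauge theory;
figures of merit are autocorrelation/cost numbers at stated couplings and volumes; no
continuum-physics claim.  (SCALAR calibration rung S0-A: not a gauge result.)

Venture `LatticeQCDFlow` (cell pub-lqcd), topic `Exactness`; FANOUT row 2 (`s0-phi4`, FLOW arm).
NEW WORK of the cell (elementary: a pointwise minorization, one Fubini symmetrization, one
AM–GM), preparing the ACCEPTANCE-WEIGHTED CEILING on `τ_int` of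
`IMHTauIntLeAcceptanceCeiling.lean`.  Printed counterpart NAMED ONLY: Deligiannidis–Lee 2018
(Ann. Appl. Probab. 28) Prop. "comparison with self-normalised importance sampling"
(`var(f,P) ≤ 2π̃(f²/ρ²) − π(f²)`, via the jump chain of Doucet et al. 2015 and a variational
formula); here a direct route: the symmetrised flow `s(t,t') = min(w(t)q(t'), w(t')q(t))` of the
sampler dominates the rank-one kernel `ρ(t)ρ(t')w(t)w(t')/Z` (`ρ` the per-state acceptance), which
gives a Poincaré-type lower bound on the Dirichlet form with constant `ā = E_π[ρ]`.

## What is proved (`w, q > 0` measurable integrable, `∫ q = 1`, `Z = ∫ w`, `b = w/q`,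
`ρ(t) = 1 − λ(b(t))` the acceptance probability from `t`, `ā Z = ∫ ρ w`, `K = imhOp μ w q`,
`s = imhFlow w q`; `v` bounded measurable; `g` bounded measurable centred; `W₂ = ∫ b w < ∞`)

* `acc_mul_weight_le` (`ρ w ≤ Z q`), **`imhFlow_ge_rankOne`** — `s(t,t') ≥ ρ(t)ρ(t')w(t)w(t')/Z`;
* `sq_sub_mul_imhOp_eq` — pointwise `v² w − v (Kv) w = ∫ s(t,·)(v(t)² − v(t)v(·))`;
  **`dirichlet_eq_half_sq`** — `∫ v² w − ∫ v (Kv) w = ½ ∫∫ s(t,t')(v(t) − v(t'))²`;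
* **`dirichlet_ge`** — `∫ v² w − ∫ v (Kv) w ≥ ā ∫ ρ w v² − (∫ ρ w v)²/Z`;
* `integrable_sq_mul_weight_div_acc` — `g² w/ρ ∈ L¹` under `W₂ < ∞` (`ρ ≥ Z²/(W₂ + bZ)`).

The variational bound `2⟨g, v⟩ − 𝓔(v) ≤ (∫ g² w/ρ)/ā` and the ceiling on `τ_int` it yields are
`IMHTauIntLeAcceptanceCeiling.lean`.  NOT CLAIMED: anything numerical; HMC / local Metropolis.
-/

namespace Summit.Ventures.LatticeQCDFlow.Exactness

open Real MeasureTheory Filter Set Topology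
open Summit.Ventures.LatticeQCDFlow.Scoring

variable {X : Type*} [MeasurableSpace X] {μ : Measure X} {w q : X → ℝ}

variable [SFinite μ]

/-! ## The rank-one Doeblin minorant of the symmetrised flow -/

omit [SFinite μ] in
/-- `ρ(t) w(t) ≤ Z q(t)`: the accepted mass from `t` is at most the total target mass
(`b ρ(b) = M(b) ≤ Z`). Also `0 < ρ ≤ 1`. -/
theorem acc_mul_weight_le (hw0 : ∀ t, 0 < w t) (hwm : Measurable w) (hwi : Integrable w μ)
    (hq0 : ∀ t, 0 < q t) (hqm : Measurable q) (hqi : Integrable q μ) (hq1 : ∫ z, q z ∂μ = 1)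
    (t : X) :
    (1 - rejCurve μ w q (w t / q t)) * w t ≤ (∫ z, w z ∂μ) * q t
    ∧ 0 < 1 - rejCurve μ w q (w t / q t) ∧ 1 - rejCurve μ w q (w t / q t) ≤ 1 := by
  have hb : 0 < w t / q t := div_pos (hw0 t) (hq0 t)
  have hM := mul_one_sub_rejCurve hw0 hwm hq0 hqm hqi hq1 hb
  have hMZ : ∫ z, min (w z) (w t / q t * q z) ∂μ ≤ ∫ z, w z ∂μ := (clip_le hw0 hwm hwi hq0 hqm hb.le).1
  refine ⟨?_, sub_pos.2 (rejCurve_lt_one hw0 hwm hq0 hqm hqi hq1 hb),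
    by linarith [(rejCurve_bounds hw0 hq0 hqi hb (μ := μ)).1]⟩
  have h : w t / q t * (1 - rejCurve μ w q (w t / q t)) ≤ ∫ z, w z ∂μ := hM ▸ hMZ
  have hqt := hq0 t
  calc (1 - rejCurve μ w q (w t / q t)) * w t
      = (w t / q t * (1 - rejCurve μ w q (w t / q t))) * q t := by
        field_simp
    _ ≤ (∫ z, w z ∂μ) * q t := mul_le_mul_of_nonneg_right h hqt.le

omit [SFinite μ] in
/-- **THE RANK-ONE MINORANT**: `s(t,t') = min(w(t)q(t'), w(t')q(t)) ≥ ρ(t)ρ(t')w(t)w(t')/Z` —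
the jump chain of the flow sampler is Doeblin with constant `ā` (Deligiannidis–Lee 2018, named). -/
theorem imhFlow_ge_rankOne (hw0 : ∀ t, 0 < w t) (hwm : Measurable w) (hwi : Integrable w μ)
    (hq0 : ∀ t, 0 < q t) (hqm : Measurable q) (hqi : Integrable q μ) (hq1 : ∫ z, q z ∂μ = 1)
    (t t' : X) :
    (1 - rejCurve μ w q (w t / q t)) * (1 - rejCurve μ w q (w t' / q t')) * w t * w t'
        / (∫ z, w z ∂μ) ≤ imhFlow w q t t' := by
  have hZ : 0 < ∫ z, w z ∂μ := integral_pos_of_pos hw0 hwi hq1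
  obtain ⟨h1, hρ0, hρ1⟩ := acc_mul_weight_le hw0 hwm hwi hq0 hqm hqi hq1 t
  obtain ⟨h1', hρ0', hρ1'⟩ := acc_mul_weight_le hw0 hwm hwi hq0 hqm hqi hq1 t'
  rw [div_le_iff₀ hZ]
  unfold imhFlow
  rw [min_mul_of_nonneg _ _ hZ.le]
  refine le_min ?_ ?_
  · -- `ρ ρ' w w' ≤ (ρ' w') w ≤ Z q' w`
    calc (1 - rejCurve μ w q (w t / q t)) * (1 - rejCurve μ w q (w t' / q t')) * w t * w t'
        ≤ 1 * ((1 - rejCurve μ w q (w t' / q t')) * w t') * w t := by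
          have : 0 ≤ (1 - rejCurve μ w q (w t' / q t')) * w t' * w t :=
            mul_nonneg (mul_nonneg hρ0'.le (hw0 t').le) (hw0 t).le
          nlinarith
      _ ≤ 1 * ((∫ z, w z ∂μ) * q t') * w t := by
          refine mul_le_mul_of_nonneg_right (mul_le_mul_of_nonneg_left h1' zero_le_one) (hw0 t).le
      _ = w t * q t' * ∫ z, w z ∂μ := by ring
  · calc (1 - rejCurve μ w q (w t / q t)) * (1 - rejCurve μ w q (w t' / q t')) * w t * w t'
        ≤ ((1 - rejCurve μ w q (w t / q t)) * w t) * 1 * w t' := by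
          have : 0 ≤ (1 - rejCurve μ w q (w t / q t)) * w t * w t' :=
            mul_nonneg (mul_nonneg hρ0.le (hw0 t).le) (hw0 t').le
          nlinarith
      _ ≤ ((∫ z, w z ∂μ) * q t) * 1 * w t' := by
          refine mul_le_mul_of_nonneg_right (mul_le_mul_of_nonneg_right h1 zero_le_one) (hw0 t').le
      _ = w t' * q t * ∫ z, w z ∂μ := by ring

/-! ## The Dirichlet form -/

omit [SFinite μ] in
/-- `∫ s(t, t') dμ(t') = ρ(t) w(t)`: the accepted flow out of `t`. -/
theorem integral_imhFlow_eq (hw0 : ∀ t, 0 < w t) (hwm : Measurable w) (hq0 : ∀ t, 0 < q t)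
    (hqm : Measurable q) (hqi : Integrable q μ) (hq1 : ∫ z, q z ∂μ = 1) (t : X) :
    ∫ t', imhFlow w q t t' ∂μ = (1 - rejCurve μ w q (w t / q t)) * w t := by
  rw [← rejection_eq_rejCurve hw0 hq0 t]
  have ham : Measurable fun t' => imhAcceptQ w q t t' :=
    (measurable_imhAcceptQ hwm hqm).comp (measurable_const.prodMk measurable_id)
  have hαq : Integrable (fun t' => imhAcceptQ w q t t' * q t') μ := by
    refine Integrable.mono' hqi (ham.mul hqm).aestronglyMeasurable
      (Eventually.of_forall fun t' => ?_)
    rw [Real.norm_eq_abs, abs_mul, abs_of_nonneg (imhAcceptQ_nonneg hw0 hq0 t t'),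
      abs_of_pos (hq0 t')]
    exact mul_le_of_le_one_left (hq0 t').le (imhAcceptQ_le_one w q t t')
  have e1 : ∫ t', imhFlow w q t t' ∂μ = (∫ t', imhAcceptQ w q t t' * q t' ∂μ) * w t := by
    rw [← integral_mul_const]
    refine integral_congr_ae (Eventually.of_forall fun t' => ?_)
    show imhFlow w q t t' = imhAcceptQ w q t t' * q t' * w t
    rw [← imh_accept_mul_weight w q (hw0 t) (hq0 t')]
    rfl
  have e2 : ∫ t', (1 - imhAcceptQ w q t t') * q t' ∂μ = 1 - ∫ t', imhAcceptQ w q t t' * q t' ∂μ := by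
    have e : ∀ t', (1 - imhAcceptQ w q t t') * q t' = q t' - imhAcceptQ w q t t' * q t' :=
      fun t' => by ring
    simp_rw [e]
    rw [integral_sub hqi hαq, hq1]
  rw [e1, e2]
  ring

omit [SFinite μ] in
/-- For fixed `t`, `t' ↦ s(t,t') h(t')` is integrable for bounded measurable `h`
(dominated by `w(t) q(t') B`). -/
theorem integrable_imhFlow_mul (hw0 : ∀ t, 0 < w t) (hwm : Measurable w) (hq0 : ∀ t, 0 < q t)
    (hqm : Measurable q) (hqi : Integrable q μ) {h : X → ℝ} (hhm : Measurable h) {B : ℝ}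
    (hhb : ∀ t, |h t| ≤ B) (t : X) : Integrable (fun t' => imhFlow w q t t' * h t') μ := by
  have hsm : Measurable fun t' => imhFlow w q t t' := by
    unfold imhFlow
    exact (measurable_const.mul hqm).min (hwm.mul measurable_const)
  refine Integrable.mono' (hqi.const_mul (w t * B)) (hsm.mul hhm).aestronglyMeasurable
    (Eventually.of_forall fun t' => ?_)
  obtain ⟨hs0, hsle⟩ := imhFlow_nonneg_le hw0 hq0 t t'
  rw [Real.norm_eq_abs, abs_mul, abs_of_nonneg hs0]
  calc imhFlow w q t t' * |h t'| ≤ w t * q t' * B :=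
        mul_le_mul hsle (hhb t') (abs_nonneg _) (mul_nonneg (hw0 t).le (hq0 t').le)
    _ = w t * B * q t' := by ring

omit [SFinite μ] in
/-- **Pointwise Dirichlet identity**: `v(t)² w(t) − v(t)(Kv)(t) w(t) = ∫ s(t,t')(v(t)² − v(t)v(t')) dμ(t')`
(the rejection terms cancel). -/
theorem sq_sub_mul_imhOp_eq (hw0 : ∀ t, 0 < w t) (hwm : Measurable w) (hq0 : ∀ t, 0 < q t)
    (hqm : Measurable q) (hqi : Integrable q μ) (hq1 : ∫ z, q z ∂μ = 1) {v : X → ℝ}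
    (hvm : Measurable v) {B : ℝ} (hvb : ∀ t, |v t| ≤ B) (t : X) :
    v t ^ 2 * w t - v t * imhOp μ w q v t * w t
      = ∫ t', imhFlow w q t t' * (v t ^ 2 - v t * v t') ∂μ := by
  rw [mul_imhOp_mul_eq hw0 hwm hq0 hqm hqi hq1 hvm hvb t, rejection_eq_rejCurve hw0 hq0 t]
  have hI1 : Integrable (fun t' => imhFlow w q t t' * v t ^ 2) μ :=
    (integrable_imhFlow_mul hw0 hwm hq0 hqm hqi measurable_const (fun _ => le_refl |(1:ℝ)|) t
      |>.mul_const (v t ^ 2)).congr (Eventually.of_forall fun t' => by simp)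
  have hI2 : Integrable (fun t' => imhFlow w q t t' * v t' * v t) μ :=
    (integrable_imhFlow_mul hw0 hwm hq0 hqm hqi hvm hvb t).mul_const (v t)
  have e : ∀ t', imhFlow w q t t' * (v t ^ 2 - v t * v t')
      = imhFlow w q t t' * v t ^ 2 - imhFlow w q t t' * v t' * v t := fun t' => by ring
  simp_rw [e]
  have hA : ∫ t', imhFlow w q t t' * v t ^ 2 ∂μ = (1 - rejCurve μ w q (w t / q t)) * w t * v t ^ 2 := by
    rw [integral_mul_const, integral_imhFlow_eq hw0 hwm hq0 hqm hqi hq1 t]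
  have hB : ∫ t', imhFlow w q t t' * v t' * v t ∂μ = (∫ t', imhFlow w q t t' * v t' ∂μ) * v t :=
    integral_mul_const _ _
  rw [integral_sub hI1 hI2, hA, hB]
  ring

omit [SFinite μ] in
/-- The symmetrised-flow form `s(t,t') a(t) c(t')` is integrable on `μ ⊗ μ` for bounded
measurable `a`, `c` (dominated by `w ⊗ q`). -/
theorem integrable_imhFlow_form (hw0 : ∀ t, 0 < w t) (hwm : Measurable w) (hwi : Integrable w μ)
    (hq0 : ∀ t, 0 < q t) (hqm : Measurable q) (hqi : Integrable q μ) {a c : X → ℝ}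
    (ham : Measurable a) (hcm : Measurable c) {Ba Bc : ℝ} (hab : ∀ t, |a t| ≤ Ba)
    (hcb : ∀ t, |c t| ≤ Bc) :
    Integrable (fun p : X × X => imhFlow w q p.1 p.2 * (a p.1 * c p.2)) (μ.prod μ) := by
  have h := integrable_imhFlow_mul_mul hw0 hwm hwi hq0 hqm hqi hcm ham hcb hab
  exact h.congr (Eventually.of_forall fun p => by ring)

/-- **THE DIRICHLET FORM**: `∫ v² w − ∫ v (Kv) w = ½ ∫_{μ⊗μ} s(t,t') (v(t) − v(t'))²`
(Fubini + symmetry of `s`). -/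
theorem dirichlet_eq_half_sq (hw0 : ∀ t, 0 < w t) (hwm : Measurable w) (hwi : Integrable w μ)
    (hq0 : ∀ t, 0 < q t) (hqm : Measurable q) (hqi : Integrable q μ) (hq1 : ∫ z, q z ∂μ = 1)
    {v : X → ℝ} (hvm : Measurable v) {B : ℝ} (hvb : ∀ t, |v t| ≤ B) :
    (∫ t, v t ^ 2 * w t ∂μ) - ∫ t, v t * imhOp μ w q v t * w t ∂μ
      = (1 / 2) * ∫ p, imhFlow w q p.1 p.2 * (v p.1 - v p.2) ^ 2 ∂(μ.prod μ) := by
  have hv2m : Measurable fun t => v t ^ 2 := hvm.pow_const 2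
  have hv2b : ∀ t, |v t ^ 2| ≤ B ^ 2 := fun t => by
    rw [abs_pow]; exact pow_le_pow_left₀ (abs_nonneg _) (hvb t) 2
  have h1b : ∀ t : X, |(fun _ : X => (1:ℝ)) t| ≤ 1 := fun _ => by simp
  -- the product integrands
  have hA : Integrable (fun p : X × X => imhFlow w q p.1 p.2 * (v p.1 ^ 2 * (1:ℝ))) (μ.prod μ) :=
    integrable_imhFlow_form hw0 hwm hwi hq0 hqm hqi hv2m measurable_const hv2b h1b
  have hBB : Integrable (fun p : X × X => imhFlow w q p.1 p.2 * (v p.1 * v p.2)) (μ.prod μ) :=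
    integrable_imhFlow_form hw0 hwm hwi hq0 hqm hqi hvm hvm hvb hvb
  have hF : Integrable (fun p : X × X => imhFlow w q p.1 p.2 * (v p.1 ^ 2 - v p.1 * v p.2))
      (μ.prod μ) := (hA.sub hBB).congr (Eventually.of_forall fun p => by
        simp only [Pi.sub_apply]; ring)
  -- LHS = ∫_prod F
  have hvKv : Integrable (fun t => v t * imhOp μ w q v t * w t) μ :=
    integrable_mul_mul_weight hw0 hwm hwi hvm (measurable_imhOp hwm hqm hvm) hvb
      (imhOp_abs_le hw0 hq0 hqi hq1 hvb)
  have hv2w : Integrable (fun t => v t ^ 2 * w t) μ :=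
    (integrable_mul_mul_weight hw0 hwm hwi hvm hvm hvb hvb).congr
      (Eventually.of_forall fun t => by ring)
  have e1 : (∫ t, v t ^ 2 * w t ∂μ) - ∫ t, v t * imhOp μ w q v t * w t ∂μ
      = ∫ p, imhFlow w q p.1 p.2 * (v p.1 ^ 2 - v p.1 * v p.2) ∂(μ.prod μ) := by
    rw [← integral_sub hv2w hvKv, integral_prod _ hF]
    exact integral_congr_ae (Eventually.of_forall fun t =>
      sq_sub_mul_imhOp_eq hw0 hwm hq0 hqm hqi hq1 hvm hvb t)
  -- ∫_prod F = ∫_prod (F ∘ swap) and F ∘ swap is the mirrored form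
  have e2 : ∫ p, imhFlow w q p.1 p.2 * (v p.1 ^ 2 - v p.1 * v p.2) ∂(μ.prod μ)
      = ∫ p, imhFlow w q p.1 p.2 * (v p.2 ^ 2 - v p.1 * v p.2) ∂(μ.prod μ) := by
    rw [← integral_prod_swap (fun p : X × X => imhFlow w q p.1 p.2 * (v p.1 ^ 2 - v p.1 * v p.2))]
    refine integral_congr_ae (Eventually.of_forall fun p => ?_)
    show imhFlow w q p.swap.1 p.swap.2 * (v p.swap.1 ^ 2 - v p.swap.1 * v p.swap.2)
      = imhFlow w q p.1 p.2 * (v p.2 ^ 2 - v p.1 * v p.2)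
    simp only [Prod.fst_swap, Prod.snd_swap]
    rw [imhFlow_symm]
    ring
  have hG : Integrable (fun p : X × X => imhFlow w q p.1 p.2 * (v p.2 ^ 2 - v p.1 * v p.2))
      (μ.prod μ) := by
    have hC : Integrable (fun p : X × X => imhFlow w q p.1 p.2 * ((1:ℝ) * v p.2 ^ 2)) (μ.prod μ) :=
      integrable_imhFlow_form hw0 hwm hwi hq0 hqm hqi measurable_const hv2m h1b hv2b
    exact (hC.sub hBB).congr (Eventually.of_forall fun p => by simp only [Pi.sub_apply]; ring)
  have e3 : ∫ p, imhFlow w q p.1 p.2 * (v p.1 - v p.2) ^ 2 ∂(μ.prod μ)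
      = (∫ p, imhFlow w q p.1 p.2 * (v p.1 ^ 2 - v p.1 * v p.2) ∂(μ.prod μ))
        + ∫ p, imhFlow w q p.1 p.2 * (v p.2 ^ 2 - v p.1 * v p.2) ∂(μ.prod μ) := by
    rw [← integral_add hF hG]
    exact integral_congr_ae (Eventually.of_forall fun p => by ring)
  rw [e1, e3, ← e2]
  ring

/-- **POINCARÉ-TYPE LOWER BOUND ON THE DIRICHLET FORM**: with `ρ` the per-state acceptance,
`∫ v² w − ∫ v (Kv) w ≥ ((∫ ρ w)/Z) ∫ ρ w v² − (∫ ρ w v)²/Z` for every bounded measurable `v`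
(the rank-one minorant integrated: `½ ∫∫ ρρ'ww'/Z (v − v')²`). -/
theorem dirichlet_ge (hw0 : ∀ t, 0 < w t) (hwm : Measurable w) (hwi : Integrable w μ)
    (hq0 : ∀ t, 0 < q t) (hqm : Measurable q) (hqi : Integrable q μ) (hq1 : ∫ z, q z ∂μ = 1)
    {v : X → ℝ} (hvm : Measurable v) {B : ℝ} (hvb : ∀ t, |v t| ≤ B) :
    ((∫ t, (1 - rejCurve μ w q (w t / q t)) * w t ∂μ) / (∫ z, w z ∂μ))
        * (∫ t, (1 - rejCurve μ w q (w t / q t)) * w t * v t ^ 2 ∂μ)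
      - (∫ t, (1 - rejCurve μ w q (w t / q t)) * w t * v t ∂μ) ^ 2 / (∫ z, w z ∂μ)
      ≤ (∫ t, v t ^ 2 * w t ∂μ) - ∫ t, v t * imhOp μ w q v t * w t ∂μ := by
  set Z : ℝ := ∫ z, w z ∂μ with hZdef
  have hZ : 0 < Z := integral_pos_of_pos hw0 hwi hq1
  set ρ : X → ℝ := fun t => (1 - rejCurve μ w q (w t / q t)) with hρdef
  have hρm : Measurable ρ := measurable_const.sub ((measurable_rejCurve hwm hqm).comp (hwm.div hqm))
  have hρ01 : ∀ t, 0 < ρ t ∧ ρ t ≤ 1 := fun t =>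
    ⟨(acc_mul_weight_le hw0 hwm hwi hq0 hqm hqi hq1 t).2.1, (acc_mul_weight_le hw0 hwm hwi hq0 hqm hqi hq1 t).2.2⟩
  rw [dirichlet_eq_half_sq hw0 hwm hwi hq0 hqm hqi hq1 hvm hvb]
  -- integrable one-variable pieces `ρ w`, `ρ w v`, `ρ w v²`
  have hρw : ∀ {h : X → ℝ} (hhm : Measurable h) {Bh : ℝ} (hhb : ∀ t, |h t| ≤ Bh),
      Integrable (fun t => ρ t * w t * h t) μ := by
    intro h hhm Bh hhb
    refine (integrable_mul_mul_weight (Ba := 1) hw0 hwm hwi hρm hhm (fun t => ?_) hhb).congr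
      (Eventually.of_forall fun t => by ring)
    rw [abs_of_pos (hρ01 t).1]; exact (hρ01 t).2
  have hv2m : Measurable fun t => v t ^ 2 := hvm.pow_const 2
  have hv2b : ∀ t, |v t ^ 2| ≤ B ^ 2 := fun t => by
    rw [abs_pow]; exact pow_le_pow_left₀ (abs_nonneg _) (hvb t) 2
  have i0 : Integrable (fun t => ρ t * w t * (1:ℝ)) μ := hρw (Bh := 1) measurable_const (fun t => by simp)
  have i1 : Integrable (fun t => ρ t * w t * v t) μ := hρw hvm hvb
  have i2 : Integrable (fun t => ρ t * w t * v t ^ 2) μ := hρw hv2m hv2b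
  -- the rank-one minorant on the product, `m(p) (v₁ − v₂)² = (1/Z)[a₂ b₀ − 2 a₁ b₁ + a₀ b₂]`
  set mS : X × X → ℝ := fun p => (ρ p.1 * w p.1 * v p.1 ^ 2) * (ρ p.2 * w p.2 * 1)
      - 2 * ((ρ p.1 * w p.1 * v p.1) * (ρ p.2 * w p.2 * v p.2))
      + (ρ p.1 * w p.1 * 1) * (ρ p.2 * w p.2 * v p.2 ^ 2) with hmS
  have j1 : Integrable (fun p : X × X => ρ p.1 * w p.1 * v p.1 ^ 2 * (ρ p.2 * w p.2 * 1)) (μ.prod μ) :=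
    i2.mul_prod i0
  have j2 : Integrable (fun p : X × X => 2 * (ρ p.1 * w p.1 * v p.1 * (ρ p.2 * w p.2 * v p.2)))
      (μ.prod μ) := (i1.mul_prod i1).const_mul 2
  have j3 : Integrable (fun p : X × X => ρ p.1 * w p.1 * 1 * (ρ p.2 * w p.2 * v p.2 ^ 2)) (μ.prod μ) :=
    i0.mul_prod i2
  have j12 : Integrable (fun p : X × X => ρ p.1 * w p.1 * v p.1 ^ 2 * (ρ p.2 * w p.2 * 1)
      - 2 * (ρ p.1 * w p.1 * v p.1 * (ρ p.2 * w p.2 * v p.2))) (μ.prod μ) := j1.sub j2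
  have hmSi : Integrable mS (μ.prod μ) := j12.add j3
  have hmS_int : ∫ p, mS p ∂(μ.prod μ)
      = (∫ t, ρ t * w t * v t ^ 2 ∂μ) * (∫ t, ρ t * w t * 1 ∂μ)
        - 2 * ((∫ t, ρ t * w t * v t ∂μ) * (∫ t, ρ t * w t * v t ∂μ))
        + (∫ t, ρ t * w t * 1 ∂μ) * (∫ t, ρ t * w t * v t ^ 2 ∂μ) := by
    simp only [hmS]
    rw [integral_add j12 j3, integral_sub j1 j2, integral_const_mul]
    rw [integral_prod_mul (fun t => ρ t * w t * v t ^ 2) (fun t => ρ t * w t * 1),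
      integral_prod_mul (fun t => ρ t * w t * v t) (fun t => ρ t * w t * v t),
      integral_prod_mul (fun t => ρ t * w t * 1) (fun t => ρ t * w t * v t ^ 2)]
  -- pointwise: `mS p / Z ≤ s(p) (v₁ − v₂)²`
  have h1b : ∀ t : X, |(fun _ : X => (1:ℝ)) t| ≤ 1 := fun _ => by simp
  have hS : Integrable (fun p : X × X => imhFlow w q p.1 p.2 * (v p.1 - v p.2) ^ 2) (μ.prod μ) := by
    have hA : Integrable (fun p : X × X => imhFlow w q p.1 p.2 * (v p.1 ^ 2 * (1:ℝ))) (μ.prod μ) :=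
      integrable_imhFlow_form hw0 hwm hwi hq0 hqm hqi hv2m measurable_const hv2b h1b
    have hBB : Integrable (fun p : X × X => imhFlow w q p.1 p.2 * (v p.1 * v p.2)) (μ.prod μ) :=
      integrable_imhFlow_form hw0 hwm hwi hq0 hqm hqi hvm hvm hvb hvb
    have hC : Integrable (fun p : X × X => imhFlow w q p.1 p.2 * ((1:ℝ) * v p.2 ^ 2)) (μ.prod μ) :=
      integrable_imhFlow_form hw0 hwm hwi hq0 hqm hqi measurable_const hv2m h1b hv2b
    exact ((hA.sub (hBB.const_mul 2)).add hC).congr (Eventually.of_forall fun p => by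
      simp only [Pi.add_apply, Pi.sub_apply]; ring)
  have hpt : ∀ p : X × X, mS p / Z ≤ imhFlow w q p.1 p.2 * (v p.1 - v p.2) ^ 2 := by
    intro p
    have hmin := imhFlow_ge_rankOne hw0 hwm hwi hq0 hqm hqi hq1 p.1 p.2
    rw [← hZdef] at hmin
    have e : mS p / Z = ((1 - rejCurve μ w q (w p.1 / q p.1)) * (1 - rejCurve μ w q (w p.2 / q p.2))
        * w p.1 * w p.2 / Z) * (v p.1 - v p.2) ^ 2 := by
      simp only [hmS, hρdef]
      ring
    rw [e]
    exact mul_le_mul_of_nonneg_right hmin (sq_nonneg _)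
  have hle : (∫ p, mS p ∂(μ.prod μ)) / Z ≤ ∫ p, imhFlow w q p.1 p.2 * (v p.1 - v p.2) ^ 2 ∂(μ.prod μ) := by
    rw [← integral_div]
    exact integral_mono (hmSi.div_const Z) hS hpt
  rw [hmS_int] at hle
  -- assemble: LHS = (1/2) (∫ mS)/Z
  have eρ : (∫ t, ρ t * w t * 1 ∂μ) = ∫ t, (1 - rejCurve μ w q (w t / q t)) * w t ∂μ := by
    refine integral_congr_ae (Eventually.of_forall fun t => ?_)
    simp only [hρdef, mul_one]
  rw [eρ] at hle
  have hZne := hZ.ne'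
  have key : ((∫ t, (1 - rejCurve μ w q (w t / q t)) * w t ∂μ) / Z)
        * (∫ t, ρ t * w t * v t ^ 2 ∂μ) - (∫ t, ρ t * w t * v t ∂μ) ^ 2 / Z
      = (1 / 2) * (((∫ t, ρ t * w t * v t ^ 2 ∂μ) * (∫ t, (1 - rejCurve μ w q (w t / q t)) * w t ∂μ)
        - 2 * ((∫ t, ρ t * w t * v t ∂μ) * (∫ t, ρ t * w t * v t ∂μ))
        + (∫ t, (1 - rejCurve μ w q (w t / q t)) * w t ∂μ) * (∫ t, ρ t * w t * v t ^ 2 ∂μ)) / Z) := by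
    field_simp
    ring
  have eρ2 : (∫ t, (1 - rejCurve μ w q (w t / q t)) * w t * v t ^ 2 ∂μ) = ∫ t, ρ t * w t * v t ^ 2 ∂μ := rfl
  have eρ1 : (∫ t, (1 - rejCurve μ w q (w t / q t)) * w t * v t ∂μ) = ∫ t, ρ t * w t * v t ∂μ := rfl
  rw [eρ2, eρ1, key]
  linarith

/-- `g² w/ρ ∈ L¹` for bounded measurable `g` under a finite second weight moment
(`1/ρ ≤ (W₂ + bZ)/Z²`, `IMHAcceptanceGeHalfESS.one_sub_rejCurve_ge`). -/
theorem integrable_sq_mul_weight_div_acc (hw0 : ∀ t, 0 < w t) (hwm : Measurable w)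
    (hwi : Integrable w μ) (hq0 : ∀ t, 0 < q t) (hqm : Measurable q) (hqi : Integrable q μ)
    (hq1 : ∫ z, q z ∂μ = 1) (hW₂ : Integrable (fun x => w x / q x * w x) μ) {g : X → ℝ}
    (hgm : Measurable g) {B : ℝ} (hgb : ∀ t, |g t| ≤ B) :
    Integrable (fun t => g t ^ 2 * w t / (1 - rejCurve μ w q (w t / q t))) μ := by
  set Z : ℝ := ∫ z, w z ∂μ with hZdef
  set W : ℝ := ∫ z, w z / q z * w z ∂μ with hWdef
  have hZ : 0 < Z := integral_pos_of_pos hw0 hwi hq1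
  have hb0 : ∀ t, 0 < w t / q t := fun t => div_pos (hw0 t) (hq0 t)
  have hW0 : 0 ≤ W := integral_nonneg fun z => mul_nonneg (hb0 z).le (hw0 z).le
  have hρpos : ∀ t, 0 < 1 - rejCurve μ w q (w t / q t) := fun t =>
    (acc_mul_weight_le hw0 hwm hwi hq0 hqm hqi hq1 t).2.1
  have hg2 : ∀ t, g t ^ 2 ≤ B ^ 2 := fun t => by
    rw [← sq_abs]; exact pow_le_pow_left₀ (abs_nonneg _) (hgb t) 2
  have hdom : Integrable (fun t => B ^ 2 / Z ^ 2 * (W * w t + Z * (w t / q t * w t))) μ :=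
    ((hwi.const_mul W).add (hW₂.const_mul Z)).const_mul _
  refine Integrable.mono' hdom (((hgm.pow_const 2).mul hwm).div (measurable_const.sub
    ((measurable_rejCurve hwm hqm).comp (hwm.div hqm)))).aestronglyMeasurable
    (Eventually.of_forall fun t => ?_)
  have hρ := one_sub_rejCurve_ge hw0 hwm hwi hq0 hqm hqi hq1 hW₂ (hb0 t)
  rw [← hZdef, ← hWdef] at hρ
  have hden : 0 < W + w t / q t * Z := add_pos_of_nonneg_of_pos hW0 (mul_pos (hb0 t) hZ)
  rw [Real.norm_eq_abs, abs_of_nonneg (div_nonneg (mul_nonneg (sq_nonneg _) (hw0 t).le) (hρpos t).le)]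
  -- `g² w/ρ ≤ g² w (W + bZ)/Z² ≤ B² w (W + bZ)/Z²`
  calc g t ^ 2 * w t / (1 - rejCurve μ w q (w t / q t))
      ≤ g t ^ 2 * w t / (Z ^ 2 / (W + w t / q t * Z)) :=
        div_le_div_of_nonneg_left (mul_nonneg (sq_nonneg _) (hw0 t).le)
          (div_pos (pow_pos hZ 2) hden) hρ
    _ = g t ^ 2 * (1 / Z ^ 2 * (W * w t + Z * (w t / q t * w t))) := by
        field_simp
    _ ≤ B ^ 2 * (1 / Z ^ 2 * (W * w t + Z * (w t / q t * w t))) := by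
        refine mul_le_mul_of_nonneg_right (hg2 t) ?_
        have : 0 ≤ W * w t + Z * (w t / q t * w t) :=
          add_nonneg (mul_nonneg hW0 (hw0 t).le) (mul_nonneg hZ.le (mul_nonneg (hb0 t).le (hw0 t).le))
        exact mul_nonneg (by positivity) this
    _ = B ^ 2 / Z ^ 2 * (W * w t + Z * (w t / q t * w t)) := by ring

end Summit.Ventures.LatticeQCDFlow.Exactness
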